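import Literature.Combinatorics.SetFamily.SpreadApproximationWeighted
import Mathlib.Analysis.Complex.ExponentialBounds
import Mathlib.Algebra.BigOperators.Ring.Finset
import Mathlib.Algebra.Order.BigOperators.Group.Finset
import Mathlib.Data.Fintype.Powerset
import HarnessLib

/-!
# Cell pnp-psdrank, route `ChebyshevTracialDesign`, brick 64: rounding a homogeneous WEIGHT to a homogeneous SUBFAMILY
# (the probabilistic method, derandomised)

Setting: the Kupavskii–Zakharov vocabulary of `Literature.Combinatorics.SetFamily.SpreadApproximation(Weighted)`:
an ambient family `𝒜` of finite sets, a subfamily `ℱ ⊆ 𝒜`, a weight `y : Finset α → [0,1]`, the mass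
`wmass y P = Σ_{A ∈ P} y A`, and relative `τ`-homogeneity of a set (`IsRelHomogeneous τ 𝒜 𝒢`:
`|𝒢(S)|·|𝒜| ≤ τ^{|S|}·|𝒜(S)|·|𝒢|` for all `S`) resp. of a weight (`IsRelHomogeneousW τ 𝒜 y ℱ`:
`y(ℱ(S))·|𝒜| ≤ τ^{|S|}·|𝒜(S)|·y(ℱ)`).

THEOREM `exists_homogeneous_subfamily` (rounding). If `y|_ℱ` is `(𝒜, τ)`-homogeneous and every nonempty
star is heavy at the scale of the weight — `τ^{|S|}·|𝒜(S)|·y(ℱ)/|𝒜| ≥ 2·|α| + 10` whenever `𝒜(S) ≠ ∅` — then there is a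
SUBFAMILY `𝒢 ⊆ ℱ` inside the support of `y` which is `(𝒜, 4τ)`-homogeneous AS A SET and has `|𝒢| ≥ y(ℱ)/2`.

PROOF (the probabilistic method, written as a weighted average so that no measure theory is needed). Put the
Bernoulli product weight `P(𝒢) = Π_{A∈𝒢} y(A) · Π_{A∈ℱ∖𝒢} (1 − y(A))` on `ℱ.powerset` ("include each member
independently with probability `y`"). By `Finset.prod_add`, `Σ_𝒢 P(𝒢)·Π_{A∈𝒢} c(A) = Π_{A∈ℱ} (1 + y(A)(c(A) − 1))`
(`sum_powerset_bernoulli_mul_prod`), which is `≤ exp(Σ_A y(A)(c(A) − 1))`; with `c = 2` on the star of `S` and `1`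
elsewhere this is the exponential moment `E 2^{|𝒢(S)|} ≤ exp(y(ℱ(S)))`, with `c ≡ 1/2` it is `E 2^{−|𝒢|} ≤ exp(−y(ℱ)/2)`.
Markov's inequality on these moments (Chernoff) bounds the `P`-mass of the bad events `|𝒢(S)| > 2λ_S`
(`λ_S = τ^{|S|}|𝒜(S)|y(ℱ)/|𝒜| ≥ y(ℱ(S))` by homogeneity) by `exp(−(2 log 2 − 1)λ_S)` and of `2|𝒢| < y(ℱ)` by
`exp(−(1 − log 2)y(ℱ)/2)`; a union bound over the `≤ 2^{|α|}` sets `S` makes the expected number of bad events `< 1`,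
so some `𝒢` with `P(𝒢) > 0` (hence `𝒢 ⊆ supp y`) has none, and then `|𝒢(S)|·|𝒜| ≤ 2τ^{|S|}|𝒜(S)|y(ℱ) ≤ 4τ^{|S|}|𝒜(S)||𝒢|`.

Why (declared): the `PneNP` matching-polytope programme (cell pnp-psdrank, route `ChebyshevTracialDesign`, bricks 61–63)
needs the existence of a tight pair between a dense family of cuts and a HOMOGENEOUS WEIGHT of perfect matchings
(`y(M) = tr(Y_M)/r`); the tree proves it for homogeneous SETS (`snt_sym_oddSet_of_globalLevelD`). This file is the bridge:
round the weight to a set with the same homogeneity up to the factor `4` and half the density — no loss in the number of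
dyadic levels (the obstruction recorded for level-set layering in that cell's MEMO-14 §5(h)).
Source for the method: [cite: AlonSpencer2016, Appendix A.1 (Chernoff bounds A.1.4, A.1.12) and Ch. 3 (the basic probabilistic method)];
the statement itself is a routine application (folklore), generic in the ground type `α` (used with `α = Sym2 (Fin n)`,
`𝒜 = ℱ =` the perfect matchings of `K_n` in brick 65).
Stature: support/instrument (a combinatorial lemma; supports stmt-PneNP-19878 through bricks 61–63/65).
WHAT THIS IS NOT: no measure-theoretic probability, no optimisation of the constants `4`, `1/2`, `2|α| + 10`; nothing on
psd rank, no P-vs-NP content.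
-/

set_option linter.dupNamespace false -- `Summit.PneNP.PneNP.…`: summit = sub-problem (D-0017)

namespace Summit.PneNP.PneNP.Theorems.ChebyshevTracialDesignHomogeneousRounding

open Finset Real Literature.Combinatorics.SetFamily

variable {α : Type*} [DecidableEq α]

/-! ### The Bernoulli product weight on the powerset and its multiplicative moments -/

/-- **Master identity of the Bernoulli product weight**: for any statistic `c`,
`Σ_{𝒢 ⊆ ℱ} (Π_{A∈𝒢} y A · Π_{A∈ℱ∖𝒢} (1 − y A)) · Π_{A∈𝒢} c A = Π_{A∈ℱ} (1 + y A·(c A − 1))`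
("`E Π_{A ∈ 𝒢} c(A) = Π_A (1 + y(A)(c(A) − 1))` for independent inclusions"). [folklore] -/
theorem sum_powerset_bernoulli_mul_prod (ℱ : Finset (Finset α)) (y c : Finset α → ℝ) :
    ∑ 𝒢 ∈ ℱ.powerset, ((∏ A ∈ 𝒢, y A) * ∏ A ∈ ℱ \ 𝒢, (1 - y A)) * ∏ A ∈ 𝒢, c A =
      ∏ A ∈ ℱ, (1 + y A * (c A - 1)) := by
  have h : ∏ A ∈ ℱ, (1 + y A * (c A - 1)) = ∏ A ∈ ℱ, (y A * c A + (1 - y A)) :=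
    prod_congr rfl fun A _ => by ring
  rw [h, prod_add]
  refine sum_congr rfl fun 𝒢 _ => ?_
  rw [prod_mul_distrib]
  ring

/-- The Bernoulli product weight is a probability: `Σ_{𝒢 ⊆ ℱ} Π_{A∈𝒢} y A · Π_{A∈ℱ∖𝒢} (1 − y A) = 1`. [folklore] -/
theorem sum_powerset_bernoulli (ℱ : Finset (Finset α)) (y : Finset α → ℝ) :
    ∑ 𝒢 ∈ ℱ.powerset, (∏ A ∈ 𝒢, y A) * ∏ A ∈ ℱ \ 𝒢, (1 - y A) = 1 := by
  have h := sum_powerset_bernoulli_mul_prod ℱ y fun _ => 1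
  simp only [prod_const_one, mul_one, sub_self, mul_zero, add_zero] at h
  exact h

/-- The Bernoulli product weight is nonnegative for `0 ≤ y ≤ 1`. [folklore] -/
theorem bernoulli_nonneg {ℱ 𝒢 : Finset (Finset α)} {y : Finset α → ℝ} (hy : ∀ A, 0 ≤ y A ∧ y A ≤ 1) :
    0 ≤ (∏ A ∈ 𝒢, y A) * ∏ A ∈ ℱ \ 𝒢, (1 - y A) :=
  mul_nonneg (prod_nonneg fun A _ => (hy A).1) (prod_nonneg fun A _ => sub_nonneg.2 (hy A).2)

/-- A subfamily of positive Bernoulli weight lies inside the support of `y`. [folklore] -/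
theorem pos_of_bernoulli_pos {ℱ 𝒢 : Finset (Finset α)} {y : Finset α → ℝ} (hy : ∀ A, 0 ≤ y A ∧ y A ≤ 1)
    (hP : 0 < (∏ A ∈ 𝒢, y A) * ∏ A ∈ ℱ \ 𝒢, (1 - y A)) {A : Finset α} (hA : A ∈ 𝒢) : 0 < y A := by
  rcases (hy A).1.eq_or_lt with h | h
  · exfalso
    have : ∏ B ∈ 𝒢, y B = 0 := prod_eq_zero hA h.symm
    rw [this, zero_mul] at hP
    exact lt_irrefl _ hP
  · exact h

/-- **Exponential-moment bound**: for `0 ≤ y ≤ 1` and a nonnegative statistic `c`,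
`Σ_{𝒢 ⊆ ℱ} P(𝒢) · Π_{A∈𝒢} c A ≤ exp(Σ_{A∈ℱ} y A·(c A − 1))` (`1 + t ≤ e^t` factorwise). [folklore] -/
theorem sum_powerset_bernoulli_mul_prod_le (ℱ : Finset (Finset α)) {y c : Finset α → ℝ}
    (hy : ∀ A, 0 ≤ y A ∧ y A ≤ 1) (hc : ∀ A, 0 ≤ c A) :
    ∑ 𝒢 ∈ ℱ.powerset, ((∏ A ∈ 𝒢, y A) * ∏ A ∈ ℱ \ 𝒢, (1 - y A)) * ∏ A ∈ 𝒢, c A ≤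
      Real.exp (∑ A ∈ ℱ, y A * (c A - 1)) := by
  rw [sum_powerset_bernoulli_mul_prod, Real.exp_sum]
  refine prod_le_prod (fun A _ => ?_) fun A _ => ?_
  · have h1 : 1 + y A * (c A - 1) = (1 - y A) + y A * c A := by ring
    rw [h1]
    exact add_nonneg (sub_nonneg.2 (hy A).2) (mul_nonneg (hy A).1 (hc A))
  · have := Real.add_one_le_exp (y A * (c A - 1))
    linarith

/-- The moment of the STAR COUNT: `Σ_{𝒢 ⊆ ℱ} P(𝒢) · 2^{|𝒢(S)|} ≤ exp(y(ℱ(S)))`. [folklore] -/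
theorem sum_powerset_bernoulli_two_pow_le (ℱ : Finset (Finset α)) {y : Finset α → ℝ}
    (hy : ∀ A, 0 ≤ y A ∧ y A ≤ 1) (S : Finset α) :
    ∑ 𝒢 ∈ ℱ.powerset, ((∏ A ∈ 𝒢, y A) * ∏ A ∈ ℱ \ 𝒢, (1 - y A)) * (2 : ℝ) ^ #(supersets 𝒢 S) ≤
      Real.exp (wmass y (supersets ℱ S)) := by
  classical
  have hc : ∀ A : Finset α, (0 : ℝ) ≤ if S ⊆ A then 2 else 1 := fun A => by split_ifs <;> norm_num
  have key := sum_powerset_bernoulli_mul_prod_le ℱ hy hc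
  have hpow : ∀ 𝒢 : Finset (Finset α), ∏ A ∈ 𝒢, (if S ⊆ A then (2 : ℝ) else 1) = (2 : ℝ) ^ #(supersets 𝒢 S) := by
    intro 𝒢
    rw [prod_ite, prod_const_one, mul_one, prod_const]
    rfl
  have hsum : ∑ A ∈ ℱ, y A * ((if S ⊆ A then (2 : ℝ) else 1) - 1) = wmass y (supersets ℱ S) := by
    rw [wmass, supersets, sum_filter]
    exact sum_congr rfl fun A _ => by split_ifs <;> ring
  simpa only [hpow, hsum] using key

/-- The moment of the TOTAL COUNT: `Σ_{𝒢 ⊆ ℱ} P(𝒢) · 2^{−|𝒢|} ≤ exp(−y(ℱ)/2)`. [folklore] -/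
theorem sum_powerset_bernoulli_half_pow_le (ℱ : Finset (Finset α)) {y : Finset α → ℝ}
    (hy : ∀ A, 0 ≤ y A ∧ y A ≤ 1) :
    ∑ 𝒢 ∈ ℱ.powerset, ((∏ A ∈ 𝒢, y A) * ∏ A ∈ ℱ \ 𝒢, (1 - y A)) * (1 / 2 : ℝ) ^ #𝒢 ≤
      Real.exp (-(wmass y ℱ / 2)) := by
  have hc : ∀ _A : Finset α, (0 : ℝ) ≤ 1 / 2 := fun _ => by norm_num
  have key := sum_powerset_bernoulli_mul_prod_le ℱ hy hc
  have hpow : ∀ 𝒢 : Finset (Finset α), ∏ _A ∈ 𝒢, (1 / 2 : ℝ) = (1 / 2 : ℝ) ^ #𝒢 := fun 𝒢 => prod_const _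
  have hsum : ∑ A ∈ ℱ, y A * ((1 / 2 : ℝ) - 1) = -(wmass y ℱ / 2) := by
    rw [wmass, ← sum_mul]
    ring
  simpa only [hpow, hsum] using key

/-! ### Markov's inequality at base 2 -/

/-- Pointwise Chernoff step (upper tail): `[2λ < k] ≤ 2^k · exp(−2λ·log 2)`. [folklore] -/
theorem indicator_lt_le_two_pow (lam : ℝ) (k : ℕ) :
    (if 2 * lam < k then (1 : ℝ) else 0) ≤ (2 : ℝ) ^ k * Real.exp (-(Real.log 2 * (2 * lam))) := by
  have e2 : Real.exp (Real.log 2 * k) = (2 : ℝ) ^ k := by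
    rw [mul_comm, Real.exp_nat_mul, Real.exp_log two_pos]
  split_ifs with h
  · rw [← e2, ← Real.exp_add]
    have : 0 ≤ Real.log 2 * k + -(Real.log 2 * (2 * lam)) := by
      have hl : 0 < Real.log 2 := Real.log_pos one_lt_two
      nlinarith
    calc (1 : ℝ) = Real.exp 0 := Real.exp_zero.symm
      _ ≤ _ := Real.exp_le_exp.2 this
  · positivity

/-- Pointwise Chernoff step (lower tail): `[2k < m] ≤ (1/2)^k · exp(log 2 · m/2)`. [folklore] -/
theorem indicator_lt_le_half_pow (m : ℝ) (k : ℕ) :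
    (if 2 * (k : ℝ) < m then (1 : ℝ) else 0) ≤ (1 / 2 : ℝ) ^ k * Real.exp (Real.log 2 * (m / 2)) := by
  have e2 : Real.exp (Real.log 2 * k) = (2 : ℝ) ^ k := by
    rw [mul_comm, Real.exp_nat_mul, Real.exp_log two_pos]
  split_ifs with h
  · have h2 : (2 : ℝ) ^ k ≤ Real.exp (Real.log 2 * (m / 2)) := by
      rw [← e2]
      exact Real.exp_le_exp.2 (by have hl : 0 < Real.log 2 := Real.log_pos one_lt_two; nlinarith)
    have h3 : (1 / 2 : ℝ) ^ k * (2 : ℝ) ^ k = 1 := by rw [← mul_pow]; norm_num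
    calc (1 : ℝ) = (1 / 2 : ℝ) ^ k * (2 : ℝ) ^ k := h3.symm
      _ ≤ (1 / 2 : ℝ) ^ k * Real.exp (Real.log 2 * (m / 2)) :=
          mul_le_mul_of_nonneg_left h2 (by positivity)
  · positivity

/-! ### Numerical constants -/

/-- `exp(−(1 − log 2)·5) ≤ 1/2`. [folklore] -/
theorem exp_neg_five_mul_le_half : Real.exp (-((1 - Real.log 2) * 5)) ≤ 1 / 2 := by
  have hl := Real.log_two_lt_d9
  have h1 : (1 : ℝ) ≤ (1 - Real.log 2) * 5 := by linarith
  have h2 : (2 : ℝ) ≤ Real.exp ((1 - Real.log 2) * 5) := by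
    have := Real.add_one_le_exp ((1 - Real.log 2) * 5); linarith
  rw [Real.exp_neg, inv_eq_one_div, div_le_div_iff₀ (by positivity) (by norm_num)]
  linarith

/-- `2^K · exp((2K + 10)(1 − 2 log 2)) ≤ 1/4`: the union bound over all `S ⊆ α` is affordable. [folklore] -/
theorem two_pow_mul_exp_le_quarter (K : ℕ) :
    (2 : ℝ) ^ K * Real.exp ((2 * K + 10) * (1 - 2 * Real.log 2)) ≤ 1 / 4 := by
  have hl := Real.log_two_gt_d9
  have e2 : Real.exp (Real.log 2 * K) = (2 : ℝ) ^ K := by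
    rw [mul_comm, Real.exp_nat_mul, Real.exp_log two_pos]
  rw [← e2, ← Real.exp_add]
  have h1 : Real.log 2 * K + (2 * K + 10) * (1 - 2 * Real.log 2) ≤ -3 := by
    have hK : (0 : ℝ) ≤ K := Nat.cast_nonneg K
    nlinarith
  have h2 : (4 : ℝ) ≤ Real.exp 3 := by have := Real.add_one_le_exp (3 : ℝ); linarith
  calc Real.exp (Real.log 2 * K + (2 * K + 10) * (1 - 2 * Real.log 2)) ≤ Real.exp (-3) := Real.exp_le_exp.2 h1
    _ = (Real.exp 3)⁻¹ := Real.exp_neg 3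
    _ ≤ 1 / 4 := by rw [inv_eq_one_div, div_le_div_iff₀ (by positivity) (by norm_num)]; linarith

/-! ### The rounding theorem -/

/-- **Rounding a homogeneous weight to a homogeneous set.** Let `ℱ ⊆ 𝒜` be finite families of subsets of a
finite type `α`, `0 ≤ y ≤ 1` a weight whose restriction to `ℱ` is `(𝒜, τ)`-homogeneous (`τ ≥ 0`), and suppose
every nonempty star is heavy: `(2|α| + 10)·|𝒜| ≤ τ^{|S|}·|𝒜(S)|·y(ℱ)` whenever `𝒜(S) ≠ ∅`. Then some subfamily
`𝒢 ⊆ ℱ` with `y > 0` on `𝒢` is `(𝒜, 4τ)`-homogeneous as a set and satisfies `y(ℱ) ≤ 2|𝒢|`.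
(Probabilistic method: independent rounding with probabilities `y`, Chernoff bounds for the `≤ 2^{|α|}` star
counts and for `|𝒢|`, union bound; derandomised as a weighted average over `ℱ.powerset`.)
[cite: AlonSpencer2016, Appendix A.1 (Chernoff bounds) and Ch. 3 (the probabilistic method)] -/
theorem exists_homogeneous_subfamily [Fintype α] {τ : ℝ} (hτ : 0 ≤ τ) {𝒜 ℱ : Finset (Finset α)}
    (hℱ𝒜 : ℱ ⊆ 𝒜) {y : Finset α → ℝ} (hy : ∀ A, 0 ≤ y A ∧ y A ≤ 1) (hhom : IsRelHomogeneousW τ 𝒜 y ℱ)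
    (hΛ : ∀ S : Finset α, (supersets 𝒜 S).Nonempty →
      (2 * Fintype.card α + 10 : ℝ) * #𝒜 ≤ τ ^ #S * #(supersets 𝒜 S) * wmass y ℱ) :
    ∃ 𝒢 ⊆ ℱ, (∀ A ∈ 𝒢, 0 < y A) ∧ IsRelHomogeneous (4 * τ) 𝒜 𝒢 ∧ wmass y ℱ ≤ 2 * #𝒢 := by
  classical
  rcases 𝒜.eq_empty_or_nonempty with h𝒜 | h𝒜
  · -- degenerate case: everything is empty
    subst h𝒜
    have hℱ : ℱ = ∅ := subset_empty.1 hℱ𝒜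
    subst hℱ
    exact ⟨∅, empty_subset _, fun A hA => (notMem_empty A hA).elim, isRelHomogeneous_empty _ _, by simp⟩
  have hApos : (0 : ℝ) < #𝒜 := by exact_mod_cast h𝒜.card_pos
  set m : ℝ := wmass y ℱ with hm_def
  set K : ℕ := Fintype.card α with hK_def
  -- the mass is large (the star of `S = ∅`)
  have hm : (2 * K + 10 : ℝ) ≤ m := by
    have h := hΛ ∅ (by rwa [supersets_emptyset])
    rw [supersets_emptyset, card_empty, pow_zero, one_mul] at h
    nlinarith
  -- the thresholds `λ_S`
  set lam : Finset α → ℝ := fun S => τ ^ #S * #(supersets 𝒜 S) * m / #𝒜 with hlam_def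
  have hlam_mass : ∀ S, wmass y (supersets ℱ S) ≤ lam S := fun S => by
    rw [hlam_def]; dsimp only
    rw [le_div_iff₀ hApos]
    exact hhom S
  have hlam_big : ∀ S, (supersets 𝒜 S).Nonempty → (2 * K + 10 : ℝ) ≤ lam S := fun S hS => by
    rw [hlam_def]; dsimp only
    rw [le_div_iff₀ hApos]
    exact hΛ S hS
  -- the Bernoulli weight and the bad-event count
  set P : Finset (Finset α) → ℝ := fun 𝒢 => (∏ A ∈ 𝒢, y A) * ∏ A ∈ ℱ \ 𝒢, (1 - y A) with hP_def
  set 𝒮 : Finset (Finset α) := univ.filter fun S => (supersets 𝒜 S).Nonempty with h𝒮_def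
  set bad : Finset (Finset α) → ℝ := fun 𝒢 =>
    (if 2 * (#𝒢 : ℝ) < m then (1 : ℝ) else 0) +
      ∑ S ∈ 𝒮, (if 2 * lam S < #(supersets 𝒢 S) then (1 : ℝ) else 0) with hbad_def
  have hP0 : ∀ 𝒢, 0 ≤ P 𝒢 := fun 𝒢 => bernoulli_nonneg hy
  have hP1 : ∑ 𝒢 ∈ ℱ.powerset, P 𝒢 = 1 := sum_powerset_bernoulli ℱ y
  -- (1) the lower tail of `|𝒢|`
  have h1 : ∑ 𝒢 ∈ ℱ.powerset, P 𝒢 * (if 2 * (#𝒢 : ℝ) < m then (1 : ℝ) else 0) ≤ 1 / 2 := by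
    calc ∑ 𝒢 ∈ ℱ.powerset, P 𝒢 * (if 2 * (#𝒢 : ℝ) < m then (1 : ℝ) else 0)
        ≤ ∑ 𝒢 ∈ ℱ.powerset, P 𝒢 * ((1 / 2 : ℝ) ^ #𝒢 * Real.exp (Real.log 2 * (m / 2))) :=
          sum_le_sum fun 𝒢 _ => mul_le_mul_of_nonneg_left (indicator_lt_le_half_pow m #𝒢) (hP0 𝒢)
      _ = (∑ 𝒢 ∈ ℱ.powerset, P 𝒢 * (1 / 2 : ℝ) ^ #𝒢) * Real.exp (Real.log 2 * (m / 2)) := by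
          rw [sum_mul]; exact sum_congr rfl fun 𝒢 _ => by ring
      _ ≤ Real.exp (-(m / 2)) * Real.exp (Real.log 2 * (m / 2)) :=
          mul_le_mul_of_nonneg_right (sum_powerset_bernoulli_half_pow_le ℱ hy) (Real.exp_pos _).le
      _ = Real.exp (-((1 - Real.log 2) * (m / 2))) := by rw [← Real.exp_add]; ring_nf
      _ ≤ Real.exp (-((1 - Real.log 2) * 5)) := Real.exp_le_exp.2 (by
          have hl := Real.log_two_lt_d9
          nlinarith)
      _ ≤ 1 / 2 := exp_neg_five_mul_le_half
  -- (2) the upper tail of each star count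
  have h2 : ∀ S ∈ 𝒮, ∑ 𝒢 ∈ ℱ.powerset, P 𝒢 * (if 2 * lam S < #(supersets 𝒢 S) then (1 : ℝ) else 0) ≤
      Real.exp ((2 * K + 10) * (1 - 2 * Real.log 2)) := by
    intro S hS
    have hS' : (supersets 𝒜 S).Nonempty := (mem_filter.1 hS).2
    calc ∑ 𝒢 ∈ ℱ.powerset, P 𝒢 * (if 2 * lam S < #(supersets 𝒢 S) then (1 : ℝ) else 0)
        ≤ ∑ 𝒢 ∈ ℱ.powerset, P 𝒢 * ((2 : ℝ) ^ #(supersets 𝒢 S) * Real.exp (-(Real.log 2 * (2 * lam S)))) :=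
          sum_le_sum fun 𝒢 _ => mul_le_mul_of_nonneg_left (indicator_lt_le_two_pow (lam S) _) (hP0 𝒢)
      _ = (∑ 𝒢 ∈ ℱ.powerset, P 𝒢 * (2 : ℝ) ^ #(supersets 𝒢 S)) * Real.exp (-(Real.log 2 * (2 * lam S))) := by
          rw [sum_mul]; exact sum_congr rfl fun 𝒢 _ => by ring
      _ ≤ Real.exp (wmass y (supersets ℱ S)) * Real.exp (-(Real.log 2 * (2 * lam S))) :=
          mul_le_mul_of_nonneg_right (sum_powerset_bernoulli_two_pow_le ℱ hy S) (Real.exp_pos _).le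
      _ ≤ Real.exp (lam S) * Real.exp (-(Real.log 2 * (2 * lam S))) :=
          mul_le_mul_of_nonneg_right (Real.exp_le_exp.2 (hlam_mass S)) (Real.exp_pos _).le
      _ = Real.exp (lam S * (1 - 2 * Real.log 2)) := by rw [← Real.exp_add]; ring_nf
      _ ≤ Real.exp ((2 * K + 10) * (1 - 2 * Real.log 2)) := Real.exp_le_exp.2 (by
          have hl := Real.log_two_gt_d9
          have hneg : 1 - 2 * Real.log 2 ≤ 0 := by linarith
          exact mul_le_mul_of_nonpos_right (hlam_big S hS') hneg)
  -- (3) the expected number of bad events is `< 1`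
  have h𝒮 : (#𝒮 : ℝ) ≤ (2 : ℝ) ^ K := by
    have : #𝒮 ≤ #(univ : Finset (Finset α)) := card_le_card (filter_subset _ _)
    rw [card_univ, Fintype.card_finset] at this
    exact_mod_cast this
  have key : ∑ 𝒢 ∈ ℱ.powerset, P 𝒢 * bad 𝒢 < ∑ 𝒢 ∈ ℱ.powerset, P 𝒢 := by
    rw [hP1]
    have hsplit : ∑ 𝒢 ∈ ℱ.powerset, P 𝒢 * bad 𝒢 =
        ∑ 𝒢 ∈ ℱ.powerset, P 𝒢 * (if 2 * (#𝒢 : ℝ) < m then (1 : ℝ) else 0) +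
          ∑ S ∈ 𝒮, ∑ 𝒢 ∈ ℱ.powerset, P 𝒢 * (if 2 * lam S < #(supersets 𝒢 S) then (1 : ℝ) else 0) := by
      rw [sum_comm, ← sum_add_distrib]
      exact sum_congr rfl fun 𝒢 _ => by rw [hbad_def]; dsimp only; rw [mul_add, mul_sum]
    rw [hsplit]
    have h3 : ∑ S ∈ 𝒮, ∑ 𝒢 ∈ ℱ.powerset, P 𝒢 * (if 2 * lam S < #(supersets 𝒢 S) then (1 : ℝ) else 0) ≤ 1 / 4 :=
      calc ∑ S ∈ 𝒮, ∑ 𝒢 ∈ ℱ.powerset, P 𝒢 * (if 2 * lam S < #(supersets 𝒢 S) then (1 : ℝ) else 0)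
          ≤ ∑ _S ∈ 𝒮, Real.exp ((2 * K + 10) * (1 - 2 * Real.log 2)) := sum_le_sum h2
        _ = #𝒮 * Real.exp ((2 * K + 10) * (1 - 2 * Real.log 2)) := by rw [sum_const, nsmul_eq_mul]
        _ ≤ (2 : ℝ) ^ K * Real.exp ((2 * K + 10) * (1 - 2 * Real.log 2)) :=
            mul_le_mul_of_nonneg_right h𝒮 (Real.exp_pos _).le
        _ ≤ 1 / 4 := two_pow_mul_exp_le_quarter K
    linarith
  -- (4) a good subfamily of positive weight
  obtain ⟨𝒢, h𝒢ℱ, hlt⟩ := exists_lt_of_sum_lt key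
  have h𝒢sub : 𝒢 ⊆ ℱ := mem_powerset.1 h𝒢ℱ
  have hPpos : 0 < P 𝒢 := by
    by_contra hle
    have hP0' : P 𝒢 = 0 := le_antisymm (not_lt.1 hle) (hP0 𝒢)
    rw [hP0', zero_mul] at hlt
    exact lt_irrefl _ hlt
  have hbad1 : bad 𝒢 < 1 := by
    by_contra hge
    have : P 𝒢 * 1 ≤ P 𝒢 * bad 𝒢 := mul_le_mul_of_nonneg_left (not_lt.1 hge) (hP0 𝒢)
    linarith
  have hind_nonneg : ∀ S ∈ 𝒮, (0 : ℝ) ≤ if 2 * lam S < #(supersets 𝒢 S) then (1 : ℝ) else 0 :=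
    fun S _ => by split_ifs <;> norm_num
  have hsum_nonneg : (0 : ℝ) ≤ ∑ S ∈ 𝒮, (if 2 * lam S < #(supersets 𝒢 S) then (1 : ℝ) else 0) :=
    sum_nonneg hind_nonneg
  have hind0_nonneg : (0 : ℝ) ≤ if 2 * (#𝒢 : ℝ) < m then (1 : ℝ) else 0 := by split_ifs <;> norm_num
  -- decode: the total count is large
  have hcount : m ≤ 2 * #𝒢 := by
    by_contra h
    have : (if 2 * (#𝒢 : ℝ) < m then (1 : ℝ) else 0) = 1 := if_pos (not_le.1 h)
    have hb : (1 : ℝ) ≤ bad 𝒢 := by rw [hbad_def]; dsimp only; rw [this]; linarith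
    linarith
  -- decode: every nonempty star count is small
  have hstar : ∀ S, (supersets 𝒜 S).Nonempty → (#(supersets 𝒢 S) : ℝ) ≤ 2 * lam S := by
    intro S hS
    have hS𝒮 : S ∈ 𝒮 := mem_filter.2 ⟨mem_univ _, hS⟩
    by_contra h
    have hone : (if 2 * lam S < #(supersets 𝒢 S) then (1 : ℝ) else 0) = 1 := if_pos (not_le.1 h)
    have hle : (1 : ℝ) ≤ ∑ S ∈ 𝒮, (if 2 * lam S < #(supersets 𝒢 S) then (1 : ℝ) else 0) :=
      calc (1 : ℝ) = (if 2 * lam S < #(supersets 𝒢 S) then (1 : ℝ) else 0) := hone.symm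
        _ ≤ ∑ S ∈ 𝒮, (if 2 * lam S < #(supersets 𝒢 S) then (1 : ℝ) else 0) := single_le_sum hind_nonneg hS𝒮
    have hb : (1 : ℝ) ≤ bad 𝒢 := by rw [hbad_def]; dsimp only; linarith
    linarith
  refine ⟨𝒢, h𝒢sub, fun A hA => pos_of_bernoulli_pos hy hPpos hA, fun S => ?_, hcount⟩
  -- homogeneity of the rounded set
  rcases (supersets 𝒜 S).eq_empty_or_nonempty with hS | hS
  · have h𝒢S : supersets 𝒢 S = ∅ :=
      subset_empty.1 (hS ▸ supersets_mono (h𝒢sub.trans hℱ𝒜) S)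
    rw [h𝒢S, hS, card_empty, Nat.cast_zero, zero_mul, mul_zero, zero_mul]
  rcases S.eq_empty_or_nonempty with hS0 | hS0
  · subst hS0
    rw [supersets_emptyset, supersets_emptyset, card_empty, pow_zero, one_mul, mul_comm]
  have hs1 : 1 ≤ #S := card_pos.2 hS0
  have hk := hstar S hS
  have hk' : (#(supersets 𝒢 S) : ℝ) * #𝒜 ≤ 2 * (τ ^ #S * #(supersets 𝒜 S) * m) := by
    have : 2 * lam S * #𝒜 = 2 * (τ ^ #S * #(supersets 𝒜 S) * m) := by
      rw [hlam_def]; dsimp only; field_simp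
    rw [← this]
    exact mul_le_mul_of_nonneg_right hk hApos.le
  have h4 : (4 : ℝ) * τ ^ #S ≤ (4 * τ) ^ #S := by
    rw [mul_pow]
    refine mul_le_mul_of_nonneg_right ?_ (pow_nonneg hτ _)
    calc (4 : ℝ) = 4 ^ 1 := (pow_one _).symm
      _ ≤ 4 ^ #S := pow_le_pow_right₀ (by norm_num) hs1
  have hAS : (0 : ℝ) ≤ #(supersets 𝒜 S) := Nat.cast_nonneg _
  have h𝒢0 : (0 : ℝ) ≤ #𝒢 := Nat.cast_nonneg _
  calc (#(supersets 𝒢 S) : ℝ) * #𝒜 ≤ 2 * (τ ^ #S * #(supersets 𝒜 S) * m) := hk'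
    _ ≤ 2 * (τ ^ #S * #(supersets 𝒜 S) * (2 * #𝒢)) :=
        mul_le_mul_of_nonneg_left (mul_le_mul_of_nonneg_left hcount (mul_nonneg (pow_nonneg hτ _) hAS)) (by norm_num)
    _ = (4 * τ ^ #S) * #(supersets 𝒜 S) * #𝒢 := by ring
    _ ≤ (4 * τ) ^ #S * #(supersets 𝒜 S) * #𝒢 :=
        mul_le_mul_of_nonneg_right (mul_le_mul_of_nonneg_right h4 hAS) h𝒢0

end Summit.PneNP.PneNP.Theorems.ChebyshevTracialDesignHomogeneousRounding
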